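import Summits.PneNP.PneNP.Theses.ExpanderLinearGenerators
import Summits.PneNP.PneNP.Theses.ProofCplx
import Summits.PneNP.PneNP.Theorems.ExpanderLinearGeneratorsNoPolyBoundedProofSystem
import Summits.PneNP.PneNP.Theorems.ExpanderLinearGeneratorsNoPolyBoundedProofSystemBarriers
import Literature.Computability.MetaComplexity.ProofSystemsTautProofs
import Literature.Computability.MetaComplexity.GeneratorHardnessCriterion
import Literature.Computability.Complexity.PCPProofs
import Literature.Computability.Complexity.NegCNFTranscoder
import Literature.Computability.Complexity.StringCopy
import Literature.Computability.Complexity.PairProjections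

/-!
# Disproof of `ProofcplxThesis` (stmt-PneNP-0097) — findings of the crux disprover, cycle 1

Crux `X := Summit.PneNP.PneNP.Theses.ExpanderLinearGenerators.NoPolyBoundedProofSystem`
(`= ProofCplx.ProofcplxThesis` by `Iff.rfl`) `:= ¬ HasPolyBoundedProofSystem TAUT`
— "no Cook–Reckhow proof system for `TAUT` is polynomially bounded".
Seat `refuter-cdisprove-stmt-PneNP-0097-0`, 2026-08-17. Prose lives in docstrings only.

## Findings (index)

* §0 AUDIT (docstring below): the statement is FAITHFUL. In the tree it is kernel-equivalent to
  `TAUT ∉ NP` and to `NP ≠ coNP` (`noPolyBoundedProofSystem_iff_TAUT_not_mem_NP`,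
  `noPolyBoundedProofSystem_iff_NP_ne_coNP`, both resting on the formalised Cook–Levin theorem), so a
  KILL of `X` is literally a proof of `NP = coNP` in Mathlib's `FinTM2` model (`not_X_iff_NP_eq_coNP`).
  `X` has no hypotheses and no parameters: there is no degenerate instance, no small model and no finite
  search space — the refuter's usual weapons have nothing to bite on.
* §1 LOAD-BEARING CLAUSES. `X = ¬ ∃ V, (poly-time V ∧ sound-and-complete V) ∧ poly-bounded V`; each of the
  four clauses is load-bearing — drop any one and the existential has a trivial witness, so the weakened
  `X` is FALSE: `x_false_without_polyTime` (the classical indicator of `TAUT`, proofs of length 0),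
  `x_false_without_polyBounded` (`TAUT` HAS a proof system: the tree's verified Frege/truth-table verifier,
  `exists_isProofSystemFor_TAUT_holds`), `x_false_without_soundness` (accept everything),
  `x_false_without_completeness` (accept nothing). No definitional slack: a disproof must produce a
  verifier that is simultaneously polynomial-time, sound, complete and polynomially bounded.
* §2 REFUTED STRENGTHENINGS (natural over-claims adjacent to `X`, all FALSE, sorry-free):
  - `not_X_for_SAT`: the `SAT`-analogue `¬ HasPolyBoundedProofSystem SAT` is false (`SAT ∈ NP`);
  - `not_forall_coNP_noPolyBounded`: "no `coNP` language has a p-bounded proof system" is false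
    (every `L ∈ P` has one, `hasPolyBoundedProofSystem_of_mem_P`);
  - `not_exists_easy_hard_core` (NEW, the route-relevant one): "some EASY (`P`-decidable) set of
    tautologies is hard for every proof system" is false — every proof system `V₀` extends to a proof
    system `V ⊇ V₀` in which a given easy `H ⊆ TAUT` has the empty proof (`easy_subset_has_trivial_proofs`;
    folklore behind Sadowski 2002 / Köbler–Messner–Torán 2003 on easy subsets of TAUT and optimality).
    READING FOR THIS ROUTE: for Krajíček's LINEAR generator the parameter set `{b | b ∉ Im A}` is in `P`
    (Gaussian elimination), so the `τ_b(A)` family is an easy subset of `TAUT` and can be hard for SOME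
    systems (the rungs) but never for ALL — the abstract reason behind the route's concession that no rung
    implies `X` (the family is easy from `AC⁰[2]`-Frege up). Hardness for all systems must come from a
    non-easy parameter set (Krajíček's `NP`-immune co-range, `range_hits_NP_iff_proofSystems_finite`).
  - `not_exists_np_hard_core` (sharp form): the same with `H ∈ NP` (`np_subset_has_short_proofs`:
    the `NP`-witness is the proof) — a set of tautologies is hard for all proof systems iff all its
    `NP` subsets are finite, so every `NP`-recognisable family (PHP, Tseitin, `τ_b(A)` for linear `A`,
    random `k`-CNF with a planted certificate …) tops out strictly below `X`.
* §3 THE COUNTEREXAMPLE WORLD (what a disproof must build and which techniques cannot build it):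
  `not_X_iff_NP_eq_coNP`; a disproof forces `PH = NP`, `NE = coNE`, an optimal proof system
  (`Cruxes/ProofcplxThesis/StrategySplit.lean: notX_world`, not re-proved here); neither `X` nor `¬X`
  has a relativizing proof (`disproof_shape_does_not_relativize`, from the landed
  `noPolyBoundedProofSystem_shape_not_relativizes`: BGS oracle with `NP^A = coNP^A`, Wilson's oracle with
  `NP^C ≠ coNP^C`). OPEN (not in tree): an algebrization barrier for the INCLUSION `NP ⊆ coNP`
  (AW-style pair with `NP^A ⊄ coNP^Ã`); the tree has only the `NP` vs `P` pairs.
* §4 WHY IT RESISTS (verdict of cycle 1): no kill is possible short of `NP = coNP`; no misstatement found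
  (model audit §0); every cheap attack is recorded above as a theorem about a NEIGHBOUR of `X`.

## §0 Model audit (read back symbol by symbol)

`HasPolyBoundedProofSystem TAUT = ∃ V : List Bool → List Bool → Bool,
  (IsPolyTimeVerifier V ∧ ∀ x, x ∈ TAUT ↔ ∃ π, V x π = true) ∧
  ∃ p : Polynomial ℕ, ∀ x π, V x π = true → ∃ π', π'.length ≤ p.eval x.length ∧ V x π' = true`.
* `IsPolyTimeVerifier V = PolyTimeComputable (fun p => boolPair p.1 p.2) encodeBool (uncurry V)`:
  some `Turing.TM2ComputableAux Bool Bool` halts on `boolPair x π` (length `2|x|+2+|π|`, injective,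
  `boolUnpair_boolPair`) with output `encodeBool (V x π)` within `p(|boolPair x π|)` TM2 steps.
  `FinTM2` finiteness: stacks `K`, labels `Λ`, states `σ` are `Fintype`; only the INPUT stack alphabet
  `Γ k₀` is required finite — the other `Γ k` may be infinite types, BUT every pushed symbol is `f v` for a
  push map `f : σ → Γ k` of the finite program and `v : σ` finite, and non-input stacks start empty, so
  only finitely many symbols are reachable: no exploit (checked against
  `Mathlib/Computability/TuringMachine/Computable.lean`, structure `FinTM2`). One TM2 step executes one
  bounded statement tree: time is faithful up to a constant factor.
* `TAUT = encodingPropForm.toLanguage {φ | φ.IsTautology}` with an injective prefix code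
  (`decode_encode` proved); `|encode φ| = 2·size φ + 2 + |code φ| ≥ size φ`, so "polynomial in `|x|`" is
  "polynomial in formula size (and bit-size of variable indices)" — the printed convention
  (Cook–Reckhow 1979 §1: atoms are strings). Non-codewords are outside `TAUT` and must be rejected —
  enforced by the soundness half of `IsProofSystemFor`.
* Quantifier order matches Cook–Reckhow Def. 1.3 / Krajíček Def. 1.1.1 verbatim; the bound is on `|x|`
  alone (not `|x| + |π|`), as printed.
Conclusion: faithful; the item is the printed open problem (Krajíček 2019, Problem 1.5.3).
-/

set_option linter.dupNamespace false -- `Summit.PneNP.PneNP.…` (single-conjunct summit, D-0017)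

namespace Summit.PneNP.PneNP.Cruxes.ProofcplxThesis.Disproof

open Literature.Computability.Complexity Literature.Computability.MetaComplexity
open Literature.Barriers.PneNP
open Summit.PneNP.PneNP.Theses Summit.PneNP.PneNP.Theorems

/-- The crux, by its route name (definitionally route ProofCplx's `ProofcplxThesis`). -/
abbrev X : Prop := ExpanderLinearGenerators.NoPolyBoundedProofSystem

/-- The two route decls for stmt-PneNP-0097 are one statement. -/
theorem X_iff_proofcplxThesis : X ↔ ProofCplx.ProofcplxThesis := Iff.rfl

/-- §0. `X` unfolded to its four clauses (definitional). -/
theorem X_iff_clauses :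
    X ↔ ¬ ∃ V : List Bool → List Bool → Bool,
      (IsPolyTimeVerifier V ∧ ∀ x, x ∈ TAUT ↔ ∃ π, V x π = true) ∧ IsPolyBounded V :=
  Iff.rfl

/-! ## §1 Load-bearing clauses: drop one, and the weakened crux is false -/

/-- `X` with the POLYNOMIAL-TIME clause of the verifier dropped. -/
def XWithoutPolyTime : Prop :=
  ¬ ∃ V : List Bool → List Bool → Bool, (∀ x, x ∈ TAUT ↔ ∃ π, V x π = true) ∧ IsPolyBounded V

/-- Dropping polynomial TIME kills `X`: the (noncomputable) indicator of `TAUT`, ignoring the proof,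
is sound, complete and polynomially bounded with proofs of length `0`. Any proof of `X` must use
the time bound of the verifier. [folklore] -/
theorem x_false_without_polyTime : ¬ XWithoutPolyTime := by
  classical
  intro h
  apply h
  refine ⟨fun x _ => decide (x ∈ TAUT), fun x => ?_, ⟨0, fun x π hπ => ⟨[], by simp, hπ⟩⟩⟩
  constructor
  · intro hx
    exact ⟨[], by simpa using hx⟩
  · rintro ⟨_, hx⟩
    simpa using hx

/-- `X` with the POLYNOMIAL-BOUNDEDNESS clause dropped: "`TAUT` has no proof system at all". -/
def XWithoutPolyBounded : Prop :=
  ¬ ∃ V : List Bool → List Bool → Bool, IsProofSystemFor V TAUT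

/-- Dropping polynomial BOUNDEDNESS kills `X`: `TAUT` has a Cook–Reckhow proof system (the tree's
machine-verified `textbookFrege` verifier behind a codeword test, `exists_isProofSystemFor_TAUT_holds`;
in print: truth tables). Any proof of `X` must use the length bound. [cite: CookReckhow1979, §1 (Def. 1.3, remark)] -/
theorem x_false_without_polyBounded : ¬ XWithoutPolyBounded := by
  intro h
  have h' : ∃ V, IsProofSystemFor V TAUT := exists_isProofSystemFor_TAUT_holds
  exact h h'

/-- `X` with SOUNDNESS dropped (only completeness `x ∈ TAUT → ∃ π, V x π` kept). -/
def XWithoutSoundness : Prop :=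
  ¬ ∃ V : List Bool → List Bool → Bool,
    IsPolyTimeVerifier V ∧ (∀ x ∈ TAUT, ∃ π, V x π = true) ∧ IsPolyBounded V

/-- Dropping SOUNDNESS kills `X`: the verifier accepting everything is polynomial-time
(`PolyTimeComputable.const`), complete and polynomially bounded. [folklore] -/
theorem x_false_without_soundness : ¬ XWithoutSoundness := by
  intro h
  apply h
  refine ⟨fun _ _ => true, ?_, fun x _ => ⟨[], rfl⟩, ⟨0, fun x π _ => ⟨[], by simp, rfl⟩⟩⟩
  exact PolyTimeComputable.const _ _ true

/-- `X` with COMPLETENESS dropped (only soundness `V x π → x ∈ TAUT` kept). -/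
def XWithoutCompleteness : Prop :=
  ¬ ∃ V : List Bool → List Bool → Bool,
    IsPolyTimeVerifier V ∧ (∀ x π, V x π = true → x ∈ TAUT) ∧ IsPolyBounded V

/-- Dropping COMPLETENESS kills `X`: the verifier accepting nothing is polynomial-time, sound and
(vacuously) polynomially bounded. [folklore] -/
theorem x_false_without_completeness : ¬ XWithoutCompleteness := by
  intro h
  apply h
  refine ⟨fun _ _ => false, ?_, fun x π hx => absurd hx (by simp), ⟨0, fun x π hx => absurd hx (by simp)⟩⟩
  exact PolyTimeComputable.const _ _ false

/-! ## §2 Refuted strengthenings -/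

/-- Every `NP` language has a polynomially bounded proof system (Cook–Reckhow Prop. 1.4, tree:
`hasPolyBoundedProofSystem_iff_mem_NP_holds`). [cite: CookReckhow1979, §1 Prop. 1.4] -/
theorem hasPolyBoundedProofSystem_of_mem_NP {L : Language Bool} (hL : L ∈ Nondeterministic.NP) :
    HasPolyBoundedProofSystem L :=
  (hasPolyBoundedProofSystem_iff_mem_NP_holds : HasPolyBoundedProofSystem L ↔ L ∈ Nondeterministic.NP).2 hL

/-- Every `P` language has a polynomially bounded proof system. [cite: CookReckhow1979, §1 Prop. 1.4] -/
theorem hasPolyBoundedProofSystem_of_mem_P {L : Language Bool} (hL : L ∈ Classes.P) :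
    HasPolyBoundedProofSystem L :=
  hasPolyBoundedProofSystem_of_mem_NP (P_subset_NP_holds hL)

/-- STRENGTHENING REFUTED (the `SAT` analogue of `X`): `SAT` HAS a polynomially bounded proof system
(the satisfying assignment), so `X` is specific to the `coNP` side. [cite: CookReckhow1979, §1 Prop. 1.4] -/
theorem not_X_for_SAT : ¬ ¬ HasPolyBoundedProofSystem SAT := fun h =>
  h (hasPolyBoundedProofSystem_of_mem_NP (SAT_mem_NP_holds : SAT ∈ Nondeterministic.NP))

/-- STRENGTHENING REFUTED (uniform over `coNP`): it is false that NO `coNP` language has a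
polynomially bounded proof system — every `P` language is in `coNP` and has one (witness: the
length-test language `LenLe 0 ∈ P`). So `X` cannot be attacked "class-wide"; it is about the
`coNP`-complete `TAUT` specifically. [folklore] -/
theorem not_forall_coNP_noPolyBounded :
    ¬ ∀ L ∈ coNP, ¬ HasPolyBoundedProofSystem L := by
  intro h
  have hP : (LenLe 0 : Language Bool) ∈ Classes.P := LenLe_mem_P 0
  have hco : (LenLe 0 : Language Bool) ∈ coNP := by
    show (LenLe 0 : Language Bool)ᶜ ∈ Nondeterministic.NP
    exact P_subset_NP_holds (compl_mem_P_iff.2 hP)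
  exact h _ hco (hasPolyBoundedProofSystem_of_mem_P hP)

/-- The language of pairs accepted by a polynomial-time verifier is in `P` (its machine after the
re-pairing machine `polyTimeComputable_boolUnpair`; as in the proof of Cook–Reckhow Prop. 1.4).
[cite: CookReckhow1979, §1 Prop. 1.4 (proof)] -/
theorem pairLang_mem_P {V : List Bool → List Bool → Bool} (hV : IsPolyTimeVerifier V) :
    ({w | Function.uncurry V (boolUnpair w) = true} : Language Bool) ∈ Classes.P := by
  set L' : Language Bool := {w | Function.uncurry V (boolUnpair w) = true} with hL'
  refine mem_P_iff_holds.2 (polyTimeDecidable_iff.2 ?_)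
  have hcomp : PolyTimeComputable (id : List Bool → List Bool) _root_.Computability.encodeBool
      (Function.uncurry V ∘ boolUnpair) :=
    PolyTimeComputable.comp_holds hV polyTimeComputable_boolUnpair
  have hind : L'.boolIndicator = Function.uncurry V ∘ boolUnpair := by
    funext w
    by_cases hw : Function.uncurry V (boolUnpair w) = true
    · rw [(Set.mem_iff_boolIndicator L' w).1 hw]
      exact hw.symm
    · rw [(Set.notMem_iff_boolIndicator L' w).1 hw]
      simp only [Function.comp_apply]
      cases h : Function.uncurry V (boolUnpair w)
      · rfl
      · exact absurd h hw
  rw [hind]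
  exact hcomp

/-- **Easy sets of tautologies have trivial proofs in some extension of any proof system.** For
`H ∈ P`, `H ⊆ TAUT`, and any proof system `V₀` for `TAUT`, the verifier
`V x π := [x ∈ H ∨ V₀ x π]` is a proof system for `TAUT` that accepts every `V₀`-proof and gives each
member of `H` the EMPTY proof. (Folklore; the trivial direction of the easy-subsets/optimality theory,
Sadowski, TCS 288 (2002); Köbler–Messner–Torán, Inf. Comput. 184 (2003).) [folklore] -/
theorem easy_subset_has_trivial_proofs {H : Language Bool} (hH : H ∈ Classes.P) (hHT : H ≤ TAUT)
    {V₀ : List Bool → List Bool → Bool} (hV₀ : IsProofSystemFor V₀ TAUT) :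
    ∃ V : List Bool → List Bool → Bool, IsProofSystemFor V TAUT ∧
      (∀ x π, V₀ x π = true → V x π = true) ∧ ∀ x ∈ H, V x [] = true := by
  set W : Language Bool :=
    (((fun z => (boolUnpair z).1) ⁻¹' (H : Set (List Bool)) : Set (List Bool)) : Language Bool) ⊔
      {w | Function.uncurry V₀ (boolUnpair w) = true} with hWdef
  have hW : W ∈ Classes.P :=
    union_mem_P (preimage_mem_P hH boolUnpairFst_mem_FP) (pairLang_mem_P hV₀.1)
  have hmemW : ∀ x π : List Bool, boolPair x π ∈ W ↔ x ∈ H ∨ V₀ x π = true := fun x π => by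
    change (boolUnpair (boolPair x π)).1 ∈ H ∨ Function.uncurry V₀ (boolUnpair (boolPair x π)) = true ↔ _
    rw [boolUnpair_boolPair]
    rfl
  let V : List Bool → List Bool → Bool := fun x π => W.boolIndicator (boolPair x π)
  have hVtrue : ∀ x π, V x π = true ↔ boolPair x π ∈ W := fun x π =>
    (Set.mem_iff_boolIndicator W (boolPair x π)).symm
  refine ⟨V, ⟨isPolyTimeVerifier_boolIndicator_of_mem_P hW, fun x => ?_⟩, fun x π hπ => ?_, fun x hx => ?_⟩
  · constructor
    · intro hx
      obtain ⟨π, hπ⟩ := (hV₀.mem_iff x).1 hx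
      exact ⟨π, (hVtrue x π).2 ((hmemW x π).2 (Or.inr hπ))⟩
    · rintro ⟨π, hπ⟩
      rcases (hmemW x π).1 ((hVtrue x π).1 hπ) with hxH | hV₀π
      · exact hHT hxH
      · exact hV₀.mem_of_eq_true hV₀π
  · exact (hVtrue x π).2 ((hmemW x π).2 (Or.inr hπ))
  · exact (hVtrue x []).2 ((hmemW x []).2 (Or.inl hx))

/-- **STRENGTHENING REFUTED: no easy set of tautologies is hard for all proof systems.** It is FALSE
that some `P`-decidable `H ⊆ TAUT` has, against EVERY proof system for `TAUT` and every polynomial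
bound, a member without short proofs: extend the tree's proof system for `TAUT` by `H` as an axiom
scheme (`easy_subset_has_trivial_proofs`); then every member of `H` has the proof `[]` of length
`0 ≤ p(|x|)`. Consequence for the route: a `τ`-family whose parameter set is in `P` (e.g. `b ∉ Im A`
for a LINEAR map `A`) is never hard for all proof systems; hardness for all systems (and hence `X`)
needs a non-easy co-range (Krajíček's generator conjecture). [folklore] -/
theorem not_exists_easy_hard_core :
    ¬ ∃ H : Language Bool, H ∈ Classes.P ∧ H ≤ TAUT ∧
      ∀ V : List Bool → List Bool → Bool, IsProofSystemFor V TAUT → ∀ p : Polynomial ℕ,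
        ∃ x ∈ H, ∀ π : List Bool, π.length ≤ p.eval x.length → V x π = false := by
  rintro ⟨H, hH, hHT, hhard⟩
  have h₀ : ∃ V₀, IsProofSystemFor V₀ TAUT := exists_isProofSystemFor_TAUT_holds
  obtain ⟨V₀, hV₀⟩ := h₀
  obtain ⟨V, hV, -, hHV⟩ := easy_subset_has_trivial_proofs hH hHT hV₀
  obtain ⟨x, hx, hno⟩ := hhard V hV 0
  have := hno [] (by simp)
  rw [hHV x hx] at this
  exact Bool.noConfusion this


/-- **`NP` sets of tautologies have SHORT proofs in some extension of any proof system.** For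
`H ∈ NP`, `H ⊆ TAUT`, and any proof system `V₀` for `TAUT`, the verifier
`V x π := [(|π| ≤ p |x| ∧ ⟨x, π⟩ ∈ L') ∨ V₀ x π]` (where `L' ∈ P`, `p` present `H`) is a proof system
for `TAUT` that accepts every `V₀`-proof and gives each member of `H` its `NP`-witness as a proof of
length `≤ p(|x|)`. This is the converse half of Krajíček's Lemma 19.4.1 read for arbitrary subsets of
`TAUT` (tree: `range_hits_NP_of_finite_short_proofs` for co-ranges). [cite: KrajicekProofComplexity2019, Lemma 19.4.1] -/
theorem np_subset_has_short_proofs {H : Language Bool} (hH : H ∈ Nondeterministic.NP) (hHT : H ≤ TAUT)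
    {V₀ : List Bool → List Bool → Bool} (hV₀ : IsProofSystemFor V₀ TAUT) :
    ∃ V : List Bool → List Bool → Bool, IsProofSystemFor V TAUT ∧
      (∀ x π, V₀ x π = true → V x π = true) ∧
      ∃ p : Polynomial ℕ, ∀ x ∈ H, ∃ π : List Bool, π.length ≤ p.eval x.length ∧ V x π = true := by
  obtain ⟨L', hL', p, hp⟩ := hH
  set W : Language Bool := (LenLe p ⊓ L') ⊔ {w | Function.uncurry V₀ (boolUnpair w) = true} with hWdef
  have hW : W ∈ Classes.P :=
    union_mem_P (inter_mem_P (LenLe_mem_P p) hL') (pairLang_mem_P hV₀.1)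
  have hmemW : ∀ x π : List Bool,
      boolPair x π ∈ W ↔ (π.length ≤ p.eval x.length ∧ boolPair x π ∈ L') ∨ V₀ x π = true := fun x π => by
    change (boolPair x π ∈ LenLe p ∧ boolPair x π ∈ L') ∨
        Function.uncurry V₀ (boolUnpair (boolPair x π)) = true ↔ _
    rw [boolPair_mem_LenLe, boolUnpair_boolPair]
    rfl
  let V : List Bool → List Bool → Bool := fun x π => W.boolIndicator (boolPair x π)
  have hVtrue : ∀ x π, V x π = true ↔ boolPair x π ∈ W := fun x π =>
    (Set.mem_iff_boolIndicator W (boolPair x π)).symm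
  refine ⟨V, ⟨isPolyTimeVerifier_boolIndicator_of_mem_P hW, fun x => ?_⟩, fun x π hπ => ?_, p, fun x hx => ?_⟩
  · constructor
    · intro hx
      obtain ⟨π, hπ⟩ := (hV₀.mem_iff x).1 hx
      exact ⟨π, (hVtrue x π).2 ((hmemW x π).2 (Or.inr hπ))⟩
    · rintro ⟨π, hπ⟩
      rcases (hmemW x π).1 ((hVtrue x π).1 hπ) with hxH | hV₀π
      · exact hHT ((hp x).2 ⟨π, hxH.1, hxH.2⟩)
      · exact hV₀.mem_of_eq_true hV₀π
  · exact (hVtrue x π).2 ((hmemW x π).2 (Or.inr hπ))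
  · obtain ⟨y, hy, hyL⟩ := (hp x).1 hx
    exact ⟨y, hy, (hVtrue x y).2 ((hmemW x y).2 (Or.inl ⟨hy, hyL⟩))⟩

/-- **STRENGTHENING REFUTED (sharp form): no `NP` set of tautologies is hard for all proof
systems.** It is FALSE that some `H ∈ NP`, `H ⊆ TAUT`, has against EVERY proof system for `TAUT`
and every polynomial bound a member without short proofs (`np_subset_has_short_proofs` with the
tree's proof system for `TAUT`). Together with Krajíček's criterion this is sharp: a set of
tautologies is hard for all proof systems iff all its `NP` subsets are finite — so any ladder whose
family is `NP`-recognisable (a fortiori `P`-recognisable: PHP, Tseitin on explicit graphs, `τ_b(A)`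
for a linear `A`) tops out below `X`. [cite: KrajicekProofComplexity2019, Lemma 19.4.1] -/
theorem not_exists_np_hard_core :
    ¬ ∃ H : Language Bool, H ∈ Nondeterministic.NP ∧ H ≤ TAUT ∧
      ∀ V : List Bool → List Bool → Bool, IsProofSystemFor V TAUT → ∀ q : Polynomial ℕ,
        ∃ x ∈ H, ∀ π : List Bool, π.length ≤ q.eval x.length → V x π = false := by
  rintro ⟨H, hH, hHT, hhard⟩
  have h₀ : ∃ V₀, IsProofSystemFor V₀ TAUT := exists_isProofSystemFor_TAUT_holds
  obtain ⟨V₀, hV₀⟩ := h₀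
  obtain ⟨V, hV, -, p, hHV⟩ := np_subset_has_short_proofs hH hHT hV₀
  obtain ⟨x, hx, hno⟩ := hhard V hV p
  obtain ⟨π, hπ, hVπ⟩ := hHV x hx
  have := hno π hπ
  rw [hVπ] at this
  exact Bool.noConfusion this

/-! ## §3 The counterexample world and the barriers a DISPROOF must evade -/

/-- A kill of the crux is exactly a proof of `NP = coNP` over the tree's classes.
[cite: CookReckhow1979, §1 Prop. 1.1] -/
theorem not_X_iff_NP_eq_coNP : ¬ X ↔ Nondeterministic.NP = coNP :=
  (not_congr noPolyBoundedProofSystem_iff_NP_ne_coNP).trans not_not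

/-- A kill of the crux is exactly `TAUT ∈ NP`: a polynomial-time verifier with polynomial-size
certificates for ALL propositional tautologies. [cite: CookReckhow1979, §1 Prop. 1.4] -/
theorem not_X_iff_TAUT_mem_NP : ¬ X ↔ TAUT ∈ Nondeterministic.NP :=
  (not_congr noPolyBoundedProofSystem_iff_TAUT_not_mem_NP).trans not_not

/-- **Neither the crux nor its negation relativizes** (landed barrier certificate
`noPolyBoundedProofSystem_shape_not_relativizes`): `X` is the `∅`-oracle instance of
`O ↦ NP^O ≠ coNP^O`, which fails at the Baker–Gill–Solovay oracle, while `O ↦ NP^O = coNP^O` fails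
at Wilson's oracle. For the DISPROVER: no relativizing construction of a p-bounded proof system for
`TAUT` exists. [cite: BakerGillSolovay1975, Thm. 1] -/
theorem disproof_shape_does_not_relativize :
    (¬ Relativizes fun O => NPRel O = coNPRel O) ∧ ¬ Relativizes fun O => NPRel O ≠ coNPRel O :=
  ⟨noPolyBoundedProofSystem_shape_not_relativizes.2.2, noPolyBoundedProofSystem_shape_not_relativizes.2.1⟩

/-! ## §4 Why it resists (cycle 1 verdict)

No counterexample search is possible (no parameters); the only in-model junk surface (FinTM2
finiteness, encodings) was audited and is sound; every clause of the definition is load-bearing (§1);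
the natural over-claims around `X` are refuted (§2) but none of them is `X`; and a kill is `NP = coNP`,
for which the tree certifies that relativizing methods cannot work in either direction (§3). Nothing is
sorried in this file. Next regimes for a later cycle (if re-armed with stubs): attack the PICKED line's
stubs; formalise the algebrization no-go for the inclusion `NP ⊆ coNP`; type the linear-generator
`τ`-family's parameter set `{b ∉ Im A} ∈ P` (Gaussian elimination as a TM2 machine) to instantiate
`not_exists_easy_hard_core` on the route's own family.
-/

end Summit.PneNP.PneNP.Cruxes.ProofcplxThesis.Disproof
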